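/-
Copyright (c) 2026 the pub-hodgecm-mathlib formalisation cell (harness21).  Prover seat hodgecm-mathlib-LH4-p09 (g5): Track A «(D-RAM) FOUR-FRAME» squad of crux H413, unit U2H (ii-H),
leaf (ρ2b′-X) — payer LH4-p14 (g4) socket (C) brick (C2) «H-SIDE CLOSED FORM», file (C2-ii): the TORUS DATUM of a deep elliptic element of `GL₂(F)` at ANY residue characteristic,
and its LEVEL IDENTITY `|ϖ|^{2n + d_K}·|tr g|² = |4·(tr²g − 4 det g)|`, 2026-09-04.
-/
import Literature.NumberTheory.Automorphic.QuadraticDatumOfNonsquare          -- ★ (LH4-p13 (g0)): `exists_inert_or_eisenstein_datum` (every non-square has an inert or Eisenstein datum), `henselianLocalRing_integer_adicCompletion`; brings ★ `SLTwoTreeQuadraticTorusNormalForm` (`exists_torusForm_binders_of_{inert,eisenstein}_of_deep`), ★ `exists_valuation_eq_pow`, the Valued∕ValuativeRel bridge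
import Literature.NumberTheory.Automorphic.IwahoriGL                          -- ★ `residue_eq_zero_iff_valuation_lt_one`
import HarnessLib

/-!
# The torus datum of a DEEP elliptic element of `GL₂(F)`, any residue characteristic: `h g h⁻¹ = c·(1, bw; b, 1 + bu)` with `(u, w)` INERT (`|u² + 4w| = 1`) or EISENSTEIN
# (`|u² + 4w| = |ϖ|^{d_K} ≥ |4ϖ|`), `|b| = |ϖ|ⁿ`, and the LEVEL IDENTITY `|ϖ|^{2n + d_K}·|tr g|² = |4·(tr² g − 4 det g)|` (Labesse–Langlands 1979 §2; Serre, *Local Fields* I §6, III §5)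

Topic `NumberTheory/Automorphic`; namespace `Literature.NumberTheory.Automorphic.HermitianLatticeTree` (as ★ `QuadraticDatumOfNonsquare`, ★ `SLTwoTreeQuadraticTorusNormalForm`).
THEOREMS ONLY (no definition, no instance, no notation, no named fact, no `sorry`); kernel lane `--supports stmt-HodgeConjecture-24833` (count-neutral).  Cell `pub/hodgecm-mathlib`
(D-0151), crux H413; Track A «(D-RAM) FOUR-FRAME», unit U2H (ii-H), leaf (ρ2b′-X) `stub_U2H_fixedPointCensus_typeTwo_unit0` (U2H ED. 15 :418) through payer LH4-p14 (g4)'s organ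
interface ★ p857374 `hOrgNV` (H-side clause `#Fix_{γ₂}(U₂ ⧸ K₂) + d % 2 = N_V`) and socket (C) brick (C2) «H-SIDE CLOSED FORM» (this seat): file (C2-i) ★∕p857582
`F0P3cDyRamHSideFixedCountTorusForm` gives `(q − 1)·(#Fix + d % 2) + 2 = (q + 1)·qⁿ` ∕ `2·q^{n+1}` in the torus-form tokens `(u, w; γ₁, h, c, b, n)` of a descent representative
`g ∈ GL₂(L⁺_v)`; THIS file MANUFACTURES those tokens for every `g` whose discriminant is a non-square and which is DEEP (`|tr²g − 4det g| < |4ϖ|·|tr g|²`), together with the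
LEVEL IDENTITY that ties the census depth `n` to the projective invariant `(tr²g − 4det g)∕tr²g` — the input of the level letter (C2-iii) (heir LEAD T19-05 (1): class U `2n = j_λ`,
class RK `2n + d = j_λ`).  LH4-p13 (g0) left exactly this «`γ_H` ↦ torus datum `(u, v; n)`» dictionary open ((e) proper) after landing all its bricks; no brick is re-proved here.

THE MATHEMATICS (`F` a field with a valuative relation whose valuation ring `𝒪` is a Henselian discrete valuation ring with finite residue field, `ϖ` a uniformising element,
`char F ≠ 2`; `g ∈ GL₂(F)`, `t = tr g`, `D = t² − 4 det g`).
* §1 DISCRIMINANT OF A DATUM.  For an INERT datum `(u, w)` (`u w ∈ 𝒪`, norm form `c² + ceu − e²w` anisotropic mod `𝔭`): **`|u² + 4w| = 1`** — were it `< 1`, the vector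
  `(c, e) = (u, −2)` (norm `−(u² + 4w)`) would give `|u| < 1` AND `|2| < 1`; then the residue field has characteristic `2`, squaring on it is injective hence (finite) onto, some
  `c ∈ 𝒪` has `|c² − w| < 1`, and `(c, 1)` has norm `(c² − w) + cu ∈ 𝔭` with `|1| = 1` — contradiction.  For an EISENSTEIN datum (`|u| < 1`, `|w| = |ϖ|`):
  **`|4ϖ| ≤ |u² + 4w|`** (`|u²|` is an even and `|4ϖ| = |4w|` an odd power of `|ϖ|`, so the sum has the larger of the two values) and `|u² + 4w| = |ϖ|^{d_K}` for some `d_K`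
  (the discriminant exponent of `F(τ)`, `τ² = uτ + w`).
* §2 **THE TORUS DATUM OF A DEEP ELLIPTIC ELEMENT** `exists_torusDatum_of_deep`: if `D` is a non-square and `|D| < |4ϖ|·|t|²` then there are `u w z γ₁ h c b n d_K` with
  `(u² + 4w)·z² = D`, `z ≠ 0`, `(u, w)` inert with `d_K = 0` OR Eisenstein, `|u² + 4w| = |ϖ|^{d_K}`, `↑(h g h⁻¹) = c•↑γ₁`, `↑γ₁ = (1, bw; b, 1 + bu)`, `b ∈ 𝒪`, `|det γ₁| = 1`,
  `c ≠ 0`, `|b| = |ϖ|ⁿ`, and **`|ϖ|^{2n + d_K}·|t|² = |4D|`** — ★ `exists_inert_or_eisenstein_datum` + §1 (so `|D| < |u² + 4w|·|t|²`) + ★ `exists_torusForm_binders_of_{inert,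
  eisenstein}_of_deep` (`b·(t − zu) = 2z`) + ★ `exists_valuation_eq_pow`; the level identity is `|t − zu| = |t|` (deep: `|z| < |t|`) and `|b|²|t|² = |4||z|² = |4D|∕|u² + 4w|`.
  (Vertex-ball reading: `n` is the conductor exponent of the order `𝒪[c⁻¹·hgh⁻¹] = 𝒪 + ϖⁿ𝒪[τ]` in the eigen-field; `1 + (q+1)(qⁿ − 1)∕(q − 1)` fixed vertices for an inert, `2(q^{n+1} −
  1)∕(q − 1)` for an Eisenstein eigen-order — ★ p855257.)
* AT A CM PLACE (`F = L⁺_v`, `ϖ = ϖ_v`; the instances are ★ `henselianLocalRing_integer_adicCompletion`, ★ `isDiscreteValuationRing_integer_of_compatible`): for a descent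
  representative `g` of `E₂γ₂`, `γ₂ ∈ U(Φ₂)(L⁺_v)` of TYPE (2), `D` is a non-square (★ `not_isSquare_disc_of_descent_of_not_exists_isRoot`) and §2 applies — that composition, in the
  `Valued.v` letters of the organ interface, is the Summits-side head `Theorems/F0P3cDyRamHSideClosedForm` (this seat); the output binders of §2 are LETTER FOR LETTER those of
  ★∕p857582 (C2-i) `pred_card_mul_natCard_fixedBy_add_mod_two_add_two_of_{inert,eisenstein}` (`hu hv hanis` ∕ `hu hu1 hv1`; `hc hconj hγ₁ (ha := one_mem) hb hγ₁det hbn`).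
HONEST LABEL: HC_CM is proved only modulo the 7 printed citations (2 remaining named inputs: hLiu418 = stmt-HodgeConjecture-24832, h413 = stmt-HodgeConjecture-24833) until rung 0
closes; (ρ2b′-X) stays an OPEN prover target; nothing printed is asserted here — local algebra over ★ bricks.

## References
* [LabesseLanglands1979] J.-P. Labesse, R. P. Langlands, *L-indistinguishability for SL(2)*, Canad. J. Math. 31 (1979), §2 pp. 7–8 (the quadratic tori `(a, bv; b, a + bu)` of `GL₂`,
  the conductor of `𝒪 + ϖⁿ𝒪_E`, fixed balls).
* [Serre1979] J.-P. Serre, *Local Fields*, GTM 67 (1979), Ch. I §6 Prop. 17–18 (Eisenstein equations; `𝒪_E = 𝒪[τ]`), Ch. III §5 Thm. 3 (unramified extensions: separable residue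
  extension, unit discriminant), Ch. II §3 (Hensel).
* [Kottwitz1988] R. E. Kottwitz, *Tamagawa numbers*, Ann. of Math. 127 (1988), §2 (fixed vertices of an elliptic element).
-/

set_option autoImplicit false

noncomputable section

open scoped ValuativeRel Matrix MatrixGroups WithZero
open Matrix ValuativeRel

namespace Literature.NumberTheory.Automorphic.HermitianLatticeTree

open Literature.NumberTheory.Automorphic

/-! ## §1 The discriminant `u² + 4w` of an inert ∕ Eisenstein datum -/

section Datum

variable {F : Type*} [Field F] [ValuativeRel F] {ϖ : F}

/-- `(2 : F)` and `(4 : F)` are integral. [cite: Serre1979, Ch. I §1] -/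
theorem two_mem_integer : (2 : F) ∈ 𝒪[F] ∧ (4 : F) ∈ 𝒪[F] := by
  constructor <;> simp

/-- **AN INERT DATUM HAS UNIT DISCRIMINANT: `|u² + 4w| = 1`** (finite residue field; see the module docstring for the characteristic-2 squaring step).
[cite: Serre1979, Ch. III §5 Thm. 3] -/
theorem valuation_disc_eq_one_of_inert [Finite (IsLocalRing.ResidueField 𝒪[F])] {u w : F} (hu : u ∈ 𝒪[F]) (hw : w ∈ 𝒪[F])
    (hanis : ∀ c e : F, c ∈ 𝒪[F] → e ∈ 𝒪[F] → valuation F (c ^ 2 + c * e * u - e ^ 2 * w) < 1 → valuation F c < 1 ∧ valuation F e < 1) :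
    valuation F (u ^ 2 + 4 * w) = 1 := by
  obtain ⟨h2, h4⟩ := two_mem_integer (F := F)
  have hint : u ^ 2 + 4 * w ∈ 𝒪[F] := Subring.add_mem _ (Subring.pow_mem _ hu 2) (Subring.mul_mem _ h4 hw)
  rcases ((Valuation.mem_integer_iff _ _).1 hint).lt_or_eq with hlt | heq
  swap; · exact heq
  exfalso
  -- the vector `(u, −2)` has norm `−(u² + 4w)`: so `|u| < 1` and `|2| < 1`
  have hneg2 : (-2 : F) ∈ 𝒪[F] := Subring.neg_mem _ h2
  have hN : valuation F (u ^ 2 + u * (-2) * u - (-2) ^ 2 * w) < 1 := by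
    have : u ^ 2 + u * (-2) * u - (-2) ^ 2 * w = -(u ^ 2 + 4 * w) := by ring
    rw [this, Valuation.map_neg]; exact hlt
  obtain ⟨hu1, hm2⟩ := hanis u (-2) hu hneg2 hN
  rw [Valuation.map_neg] at hm2
  -- the residue field has characteristic `2`; squaring is injective, hence onto
  set k := IsLocalRing.ResidueField 𝒪[F]
  have h2res : IsLocalRing.residue 𝒪[F] ⟨2, h2⟩ = 0 := (residue_eq_zero_iff_valuation_lt_one _).2 hm2
  have h2k : (2 : k) = 0 := by
    have h22 : (2 : 𝒪[F]) = ⟨2, h2⟩ := Subtype.ext (by push_cast; rfl)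
    rw [← h2res, ← h22, map_ofNat]
  have hinj : Function.Injective (fun x : k => x ^ 2) := by
    intro x y hxy
    simp only at hxy
    have h0 : (x - y) ^ 2 = 0 := by
      have : (x - y) ^ 2 = x ^ 2 + y ^ 2 - 2 * (x * y) := by ring
      rw [this, h2k, zero_mul, sub_zero, hxy, ← two_mul, h2k, zero_mul]
    exact sub_eq_zero.1 (pow_eq_zero_iff two_ne_zero |>.1 h0)
  have hsurj : Function.Surjective (fun x : k => x ^ 2) := Finite.surjective_of_injective hinj
  obtain ⟨cbar, hcbar⟩ := hsurj (IsLocalRing.residue 𝒪[F] ⟨w, hw⟩)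
  obtain ⟨c, rfl⟩ := IsLocalRing.residue_surjective cbar
  simp only at hcbar
  -- `|c² − w| < 1`
  have hcw : valuation F ((c : F) ^ 2 - w) < 1 := by
    have h0 : IsLocalRing.residue 𝒪[F] (c ^ 2 - ⟨w, hw⟩) = 0 := by rw [map_sub, map_pow, hcbar, sub_self]
    have := (residue_eq_zero_iff_valuation_lt_one _).1 h0
    simpa using this
  -- the vector `(c, 1)` has norm `(c² − w) + c·u ∈ 𝔭`, contradiction with `|1| = 1`
  have hc1 : valuation F (c : F) ≤ 1 := (Valuation.mem_integer_iff _ _).1 c.2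
  have hcu : valuation F ((c : F) * u) < 1 := by
    rw [map_mul]
    exact lt_of_le_of_lt (mul_le_of_le_one_left' hc1) hu1
  have hN1 : valuation F ((c : F) ^ 2 + (c : F) * 1 * u - 1 ^ 2 * w) < 1 := by
    have : (c : F) ^ 2 + (c : F) * 1 * u - 1 ^ 2 * w = ((c : F) ^ 2 - w) + (c : F) * u := by ring
    rw [this]
    exact lt_of_le_of_lt (Valuation.map_add _ _ _) (max_lt hcw hcu)
  have h := (hanis (c : F) 1 c.2 (Subring.one_mem _) hN1).2
  rw [Valuation.map_one] at h
  exact lt_irrefl _ h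

/-- **AN EISENSTEIN DATUM HAS DISCRIMINANT OF VALUE AT LEAST `|4ϖ|`: `|4ϖ| ≤ |u² + 4w|`** (`|u| < 1`, `|w| = |ϖ|`; `|u²|` is an even, `|4w| = |4ϖ|` an odd power of `|ϖ|`).
[cite: Serre1979, Ch. I §6 Prop. 17–18] -/
theorem valuation_four_mul_le_valuation_disc_of_eisenstein [IsDiscreteValuationRing 𝒪[F]] (hϖ : IsUniformizingElement ϖ) {u w : F} (hu : u ∈ 𝒪[F])
    (hw1 : valuation F w = valuation F ϖ) : valuation F (4 * ϖ) ≤ valuation F (u ^ 2 + 4 * w) := by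
  by_cases h40 : (4 : F) = 0
  · rw [h40, zero_mul, map_zero]; exact zero_le
  have h20 : (2 : F) ≠ 0 := fun h => h40 (by rw [show (4 : F) = 2 * 2 by norm_num, h, mul_zero])
  obtain ⟨h2, -⟩ := two_mem_integer (F := F)
  have h4w : valuation F (4 * w) = valuation F (4 * ϖ) := by rw [map_mul, map_mul, hw1]
  have hϖ0 : 0 < valuation F ϖ := (Valuation.pos_iff _).2 hϖ.ne_zero
  have hanti : StrictAnti (fun n : ℕ => valuation F ϖ ^ n) := pow_right_strictAnti₀ hϖ0 hϖ.valuation_lt_one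
  -- the two pure terms have different values (even vs odd power of `|ϖ|`)
  have hne : valuation F (u ^ 2) ≠ valuation F (4 * w) := by
    intro heq
    rcases eq_or_ne u 0 with hu0 | hu0
    · rw [hu0, zero_pow two_ne_zero, map_zero, eq_comm, Valuation.zero_iff, mul_eq_zero] at heq
      rcases heq with h | h
      · exact h40 h
      · rw [h, map_zero, eq_comm, Valuation.zero_iff] at hw1
        exact hϖ.ne_zero hw1
    · obtain ⟨k, hk⟩ := exists_valuation_eq_pow hϖ hu hu0
      obtain ⟨e, he⟩ := exists_valuation_eq_pow hϖ h2 h20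
      rw [map_pow, hk, ← pow_mul, h4w, map_mul, show (4 : F) = 2 ^ 2 by norm_num, map_pow, he, ← pow_mul, ← pow_succ] at heq
      have := hanti.injective heq
      omega
  rw [Valuation.map_add_of_distinct_val _ hne, ← h4w]
  exact le_max_right _ _

/-- The discriminant of an Eisenstein datum is a power of `|ϖ|`: `|u² + 4w| = |ϖ|^{d_K}` for some `d_K` (it lies in `𝒪 ∖ 0`). [cite: Serre1979, Ch. I §6 Prop. 17–18] -/
theorem exists_valuation_disc_eq_pow_of_eisenstein [IsDiscreteValuationRing 𝒪[F]] (hϖ : IsUniformizingElement ϖ) {u w : F} (hu : u ∈ 𝒪[F])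
    (hw1 : valuation F w = valuation F ϖ) (hdisc : u ^ 2 + 4 * w ≠ 0) : ∃ dK : ℕ, valuation F (u ^ 2 + 4 * w) = valuation F ϖ ^ dK := by
  have hw : w ∈ 𝒪[F] := by rw [Valuation.mem_integer_iff, hw1]; exact hϖ.valuation_le_one
  exact exists_valuation_eq_pow hϖ (Subring.add_mem _ (Subring.pow_mem _ hu 2) (Subring.mul_mem _ (two_mem_integer (F := F)).2 hw)) hdisc

end Datum

/-! ## §2 The torus datum of a deep elliptic element, with its level identity -/

section Deep

variable {F : Type*} [Field F] [ValuativeRel F] {ϖ : F}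

/-- **DEEP ⟹ `|t − zu| = |t|` and the LEVEL IDENTITY.**  If `t² − 4d = (u² + 4w)·z²`, `u ∈ 𝒪`, `|t² − 4d| < |u² + 4w|·|t|²` (deep) and `b·(t − zu) = 2z` (the torus-form relation of ★
`exists_torusForm_binders_…`), then `|z| < |t|`, `|t − zu| = |t|` and **`|b|²·|u² + 4w|·|t|² = |4·(t² − 4d)|`**. [cite: LabesseLanglands1979, §2 p. 8] -/
theorem valuation_sq_mul_disc_mul_trace_sq_eq_of_deep {t d u w z b : F} (hu : u ∈ 𝒪[F]) (hD : t ^ 2 - 4 * d = (u ^ 2 + 4 * w) * z ^ 2)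
    (hdeep : valuation F (t ^ 2 - 4 * d) < valuation F (u ^ 2 + 4 * w) * valuation F t ^ 2) (hbt : b * (t - z * u) = 2 * z) :
    valuation F (t - z * u) = valuation F t ∧ valuation F b ^ 2 * valuation F (u ^ 2 + 4 * w) * valuation F t ^ 2 = valuation F (4 * (t ^ 2 - 4 * d)) := by
  -- `|z| < |t|`
  have hz : valuation F z < valuation F t := by
    rw [hD, map_mul, map_pow] at hdeep
    by_contra hle
    rw [not_lt] at hle
    exact absurd hdeep (not_lt.2 (mul_le_mul' le_rfl (pow_le_pow_left' hle 2)))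
  have hzu : valuation F (-(z * u)) < valuation F t := by
    rw [Valuation.map_neg, map_mul]
    exact lt_of_le_of_lt (mul_le_of_le_one_right' ((Valuation.mem_integer_iff _ _).1 hu)) hz
  have htzu : valuation F (t - z * u) = valuation F t := by
    rw [sub_eq_add_neg, Valuation.map_add_eq_of_lt_left _ hzu]
  refine ⟨htzu, ?_⟩
  -- `|b|·|t| = |2z|`, squared and multiplied by `|u² + 4w|`
  have h1 : valuation F b * valuation F t = valuation F (2 * z) := by rw [← htzu, ← map_mul, hbt]
  have h2 : (valuation F b * valuation F t) ^ 2 * valuation F (u ^ 2 + 4 * w) = valuation F (4 * (t ^ 2 - 4 * d)) := by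
    rw [h1, ← map_pow, ← map_mul, hD]
    congr 1; ring
  rw [← h2]
  simp only [mul_pow, mul_comm, mul_left_comm]

/-- **THE TORUS DATUM OF A DEEP ELLIPTIC ELEMENT OF `GL₂(F)` (any residue characteristic).**  `F` with a valuative relation whose valuation ring is a Henselian discrete
valuation ring with finite residue field, `ϖ` a uniformising element, `char F ≠ 2`.  Let `g ∈ GL₂(F)` have NON-SQUARE discriminant `D = tr²g − 4 det g` (its eigen-field
`F(√D)` is a quadratic field) and be DEEP: `|D| < |4ϖ|·|tr g|²`.  THEN there are `u w z : F`, `γ₁ h : GL₂(F)`, `c b : F`, `n d_K : ℕ` with: `z ≠ 0`, `(u² + 4w)·z² = D`, `u ∈ 𝒪`;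
the datum `(u, w)` is INERT (`w ∈ 𝒪`, norm form anisotropic mod `𝔭`) with `d_K = 0`, OR EISENSTEIN (`|u| < 1`, `|w| = |ϖ|`); `|u² + 4w| = |ϖ|^{d_K}`; `c ≠ 0`,
`↑(h g h⁻¹) = c•↑γ₁`, `↑γ₁ = (1, bw; b, 1 + bu)`, `b ∈ 𝒪`, `|det γ₁| = 1`, `|b| = |ϖ|ⁿ`; and the LEVEL IDENTITY **`|ϖ|^{2n + d_K}·|tr g|² = |4D|`**.  (★ `exists_inert_or_eisenstein_datum`
+ §1 + ★ `exists_torusForm_binders_of_{inert,eisenstein}_of_deep` + ★ `exists_valuation_eq_pow`.)  These are the binders `hu hv hanis` ∕ `hu hu1 hv1`, `hc hconj hγ₁ (a := 1) hb hγ₁det hbn` of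
★ p855257 ∕ ★ `F0P3cDyRamHSideFixedCountTorusForm`. [cite: LabesseLanglands1979, §2 pp. 7–8] [cite: Serre1979, Ch. I §6 Prop. 17–18; Ch. III §5 Thm. 3] [cite: Kottwitz1988, §2] -/
theorem exists_torusDatum_of_deep [IsDiscreteValuationRing 𝒪[F]] [HenselianLocalRing 𝒪[F]] [Finite (IsLocalRing.ResidueField 𝒪[F])]
    (h2 : (2 : F) ≠ 0) (hϖ : IsUniformizingElement ϖ) (g : GL (Fin 2) F)
    (hns : ¬ IsSquare ((g : Matrix (Fin 2) (Fin 2) F).trace ^ 2 - 4 * (g : Matrix (Fin 2) (Fin 2) F).det))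
    (hdeep : valuation F ((g : Matrix (Fin 2) (Fin 2) F).trace ^ 2 - 4 * (g : Matrix (Fin 2) (Fin 2) F).det) <
      valuation F (4 * ϖ) * valuation F (g : Matrix (Fin 2) (Fin 2) F).trace ^ 2) :
    ∃ (u w z : F) (γ₁ h : GL (Fin 2) F) (c b : F) (n dK : ℕ),
      z ≠ 0 ∧ (u ^ 2 + 4 * w) * z ^ 2 = (g : Matrix (Fin 2) (Fin 2) F).trace ^ 2 - 4 * (g : Matrix (Fin 2) (Fin 2) F).det ∧ u ∈ 𝒪[F] ∧
      ((w ∈ 𝒪[F] ∧ (∀ c e : F, c ∈ 𝒪[F] → e ∈ 𝒪[F] → valuation F (c ^ 2 + c * e * u - e ^ 2 * w) < 1 → valuation F c < 1 ∧ valuation F e < 1) ∧ dK = 0) ∨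
        (valuation F u < 1 ∧ valuation F w = valuation F ϖ)) ∧
      valuation F (u ^ 2 + 4 * w) = valuation F ϖ ^ dK ∧
      c ≠ 0 ∧ ((h * g * h⁻¹ : GL (Fin 2) F) : Matrix (Fin 2) (Fin 2) F) = c • (γ₁ : Matrix (Fin 2) (Fin 2) F) ∧
      (γ₁ : Matrix (Fin 2) (Fin 2) F) = !![1, b * w; b, 1 + b * u] ∧ b ∈ 𝒪[F] ∧ valuation F (γ₁ : Matrix (Fin 2) (Fin 2) F).det = 1 ∧
      valuation F b = valuation F ϖ ^ n ∧
      valuation F ϖ ^ (2 * n + dK) * valuation F (g : Matrix (Fin 2) (Fin 2) F).trace ^ 2 =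
        valuation F (4 * ((g : Matrix (Fin 2) (Fin 2) F).trace ^ 2 - 4 * (g : Matrix (Fin 2) (Fin 2) F).det)) := by
  set t := (g : Matrix (Fin 2) (Fin 2) F).trace with ht
  set d := (g : Matrix (Fin 2) (Fin 2) F).det with hd
  have hD0 : t ^ 2 - 4 * d ≠ 0 := fun h0 => hns ⟨0, by rw [h0, mul_zero]⟩
  obtain ⟨u, w, z, hz, hmain, hu, hdat⟩ := exists_inert_or_eisenstein_datum h2 hϖ hD0 hns
  have hdisc : u ^ 2 + 4 * w ≠ 0 := fun h0 => hD0 (by rw [← hmain, h0, zero_mul])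
  have hD : t ^ 2 - 4 * d = (u ^ 2 + 4 * w) * z ^ 2 := hmain.symm
  -- `|4ϖ| ≤ |u² + 4w|` in both cases, so `g` is deep for THIS datum
  have h4le : valuation F (4 * ϖ) ≤ valuation F (u ^ 2 + 4 * w) := by
    rcases hdat with ⟨hw, hanis⟩ | ⟨_, hw1⟩
    · rw [valuation_disc_eq_one_of_inert hu hw hanis, map_mul]
      exact mul_le_one' ((Valuation.mem_integer_iff _ _).1 (two_mem_integer (F := F)).2) hϖ.valuation_le_one
    · exact valuation_four_mul_le_valuation_disc_of_eisenstein hϖ hu hw1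
  have hdeep' : valuation F (t ^ 2 - 4 * d) < valuation F (u ^ 2 + 4 * w) * valuation F t ^ 2 :=
    lt_of_lt_of_le hdeep (mul_le_mul' h4le le_rfl)
  rcases hdat with ⟨hw, hanis⟩ | ⟨hu1, hw1⟩
  · -- INERT
    obtain ⟨γ₁, hh, c, b, hc, hconj, hγ₁, hb, hγ₁det, hbt⟩ :=
      exists_torusForm_binders_of_inert_of_deep h2 ht.symm hd.symm hz hdisc hD hu hw hanis hdeep'
    have hb0 : b ≠ 0 := by
      intro h0; rw [h0, zero_mul] at hbt
      exact (mul_ne_zero h2 hz) hbt.symm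
    obtain ⟨n, hn⟩ := exists_valuation_eq_pow hϖ hb hb0
    have hdisc1 := valuation_disc_eq_one_of_inert hu hw hanis
    obtain ⟨-, hlev⟩ := valuation_sq_mul_disc_mul_trace_sq_eq_of_deep hu hD hdeep' hbt
    refine ⟨u, w, z, γ₁, hh, c, b, n, 0, hz, hmain, hu, Or.inl ⟨hw, hanis, rfl⟩, by rw [hdisc1, pow_zero], hc, hconj, hγ₁, hb, hγ₁det, hn, ?_⟩
    rw [← hlev, hn, hdisc1, add_zero, mul_one, pow_mul']
  · -- EISENSTEIN
    obtain ⟨γ₁, hh, c, b, hc, hconj, hγ₁, hb, hγ₁det, hbt⟩ :=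
      exists_torusForm_binders_of_eisenstein_of_deep h2 hϖ ht.symm hd.symm hz hdisc hD hu hu1 hw1 hdeep'
    have hb0 : b ≠ 0 := by
      intro h0; rw [h0, zero_mul] at hbt
      exact (mul_ne_zero h2 hz) hbt.symm
    obtain ⟨n, hn⟩ := exists_valuation_eq_pow hϖ hb hb0
    obtain ⟨dK, hdK⟩ := exists_valuation_disc_eq_pow_of_eisenstein hϖ hu hw1 hdisc
    obtain ⟨-, hlev⟩ := valuation_sq_mul_disc_mul_trace_sq_eq_of_deep hu hD hdeep' hbt
    refine ⟨u, w, z, γ₁, hh, c, b, n, dK, hz, hmain, hu, Or.inr ⟨hu1, hw1⟩, hdK, hc, hconj, hγ₁, hb, hγ₁det, hn, ?_⟩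
    rw [← hlev, hn, hdK, pow_add, pow_mul']

end Deep

end Literature.NumberTheory.Automorphic.HermitianLatticeTree

end
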